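import Summits.CriticalPhenomena.PercolationContinuityZ3.Theorems.PercLowPointHalfSpaceQuantitativeBGNWallTwoGhostBasics
import Literature.Probability.LatticeModels.ProdBernoulliClusterLocality
import HarnessLib

/-!
# `QuantitativeBGN` (stmt-CriticalPhenomena-0913), line `longrange-wall-ghost-bootstrap` — K1, truncated step graphs

Part of the stub `stub_wallTwoGhost` (K1, basic two-ghost inequality on the wall; template
`Literature/Probability/Percolation/TwoGhostInequalityProofs.lean`). The wall vertex `0` carries
infinitely many long bonds, so the tree's edge-by-edge exploration `ClusterExploration` (which needs a
locally finite step graph) is run on the TRUNCATED step graphs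

* `trG L`: vertices `Site 3`; steps = nearest-neighbour lattice edges inside `H = {0 ≤ x₀}` and wall
  pairs `{u,v}` (`u₀ = v₀ = 0`, `u ≠ v`) of sup-distance `≤ L`. It is locally finite, its edges are
  pairs inside `H` (`⊆ EH`) and are lattice edges or wall pairs, they increase with `L` and exhaust
  the lattice edges inside `H` together with all wall pairs.

and the truncation is removed afterwards (`…WallTwoGhostFatou.lean`) using:

* `augWall`-almost surely `res ω ⊆ ⋃_L E(trG L)` (pairs that are neither lattice edges nor wall pairs
  have probability `0`);
* the `H`-cluster of the truncated configuration `ω ∩ E(trG L)` increases to `C_H(x)` and, when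
  `C_H(x)` is finite, equals it for all large `L` (an open path uses finitely many pairs).
-/

noncomputable section

namespace Summit.CriticalPhenomena.PercolationContinuityZ3.Theorems

open MeasureTheory Filter Literature.Probability.Percolation Literature.Probability.LatticeModels
open Summit.CriticalPhenomena.PercolationContinuityZ3.Theorems.WallGhost
open scoped ENNReal

namespace WallTwoGhost
/-! ### The truncated step graphs -/

/-- **The truncated step graph `trG L`**: lattice edges inside `H` and wall pairs of sup-distance `≤ L`.
[folklore] -/
def trG (L : ℕ) : SimpleGraph (Site 3) where
  Adj u v := u ≠ v ∧ 0 ≤ u 0 ∧ 0 ≤ v 0 ∧ ((zdGraph 3).Adj u v ∨ (u 0 = 0 ∧ v 0 = 0 ∧ ‖u - v‖ ≤ L))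
  symm.symm u v h := ⟨h.1.symm, h.2.2.1, h.2.1,
    h.2.2.2.imp (fun h' => h'.symm) (fun h' => ⟨h'.2.1, h'.1, by rw [norm_sub_rev]; exact h'.2.2⟩)⟩
  loopless.irrefl u h := h.1 rfl

/-- Adjacency in `trG L`, unfolded. [folklore] -/
theorem trG_adj {L : ℕ} {u v : Site 3} : (trG L).Adj u v ↔
    u ≠ v ∧ 0 ≤ u 0 ∧ 0 ≤ v 0 ∧ ((zdGraph 3).Adj u v ∨ (u 0 = 0 ∧ v 0 = 0 ∧ ‖u - v‖ ≤ L)) := Iff.rfl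

/-- A site at sup-distance `≤ L` lies in the order box of radius `L`. [folklore] -/
theorem mem_Icc_of_norm_sub_le {u v : Site 3} {L : ℕ} (h : ‖u - v‖ ≤ L) :
    v ∈ Finset.Icc (u - fun _ => (L : ℤ)) (u + fun _ => (L : ℤ)) := by
  rw [Finset.mem_Icc]
  have hi : ∀ i, |u i - v i| ≤ (L : ℤ) := by
    intro i
    have h1 := (pi_norm_le_iff_of_nonneg (by positivity)).1 h i
    rw [Pi.sub_apply, Int.norm_eq_abs] at h1
    exact_mod_cast h1
  constructor
  · intro i
    have := (abs_le.1 (hi i)).2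
    simp only [Pi.sub_apply]; omega
  · intro i
    have := (abs_le.1 (hi i)).1
    simp only [Pi.add_apply]; omega

/-- The neighbours in `trG L` lie in a fixed finite set. [folklore] -/
theorem neighborSet_trG_subset (L : ℕ) (u : Site 3) :
    (trG L).neighborSet u ⊆ ↑((zdGraph 3).neighborFinset u ∪ Finset.Icc (u - fun _ => (L : ℤ)) (u + fun _ => (L : ℤ))) := by
  intro v hv
  rw [SimpleGraph.mem_neighborSet, trG_adj] at hv
  rw [Finset.coe_union, Set.mem_union, Finset.mem_coe, SimpleGraph.mem_neighborFinset, Finset.mem_coe]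
  rcases hv.2.2.2 with h | h
  · exact Or.inl h
  · exact Or.inr (mem_Icc_of_norm_sub_le h.2.2)

/-- `trG L` is locally finite. [folklore] -/
instance instLocallyFiniteTrG (L : ℕ) : (trG L).LocallyFinite := fun u =>
  ((Finset.finite_toSet _).subset (neighborSet_trG_subset L u)).fintype

/-- The steps of `trG L` are pairs inside `H`. [folklore] -/
theorem edgeSet_trG_subset_EH (L : ℕ) : (trG L).edgeSet ⊆ EH := by
  intro e he
  induction e using Sym2.ind with
  | h u v =>
    rw [SimpleGraph.mem_edgeSet, trG_adj] at he
    exact mk_mem_EH.2 ⟨he.1, he.2.1, he.2.2.1⟩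

/-- The steps of `trG L` are lattice edges or wall pairs. [folklore] -/
theorem edgeSet_trG_subset_union (L : ℕ) : (trG L).edgeSet ⊆ (zdGraph 3).edgeSet ∪ wallPairs := by
  intro e he
  induction e using Sym2.ind with
  | h u v =>
    rw [SimpleGraph.mem_edgeSet, trG_adj] at he
    rcases he.2.2.2 with h | h
    · exact Or.inl ((SimpleGraph.mem_edgeSet _).2 h)
    · exact Or.inr (mk_mem_wallPairs.2 ⟨h.1, h.2.1, he.1⟩)

/-- The step graphs increase with `L`. [folklore] -/
theorem edgeSet_trG_mono {L L' : ℕ} (h : L ≤ L') : (trG L).edgeSet ⊆ (trG L').edgeSet := by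
  intro e he
  induction e using Sym2.ind with
  | h u v =>
    rw [SimpleGraph.mem_edgeSet, trG_adj] at he ⊢
    refine ⟨he.1, he.2.1, he.2.2.1, he.2.2.2.imp id fun h' => ⟨h'.1, h'.2.1, h'.2.2.trans ?_⟩⟩
    exact_mod_cast h

/-- The step graphs exhaust the lattice edges inside `H` and the wall pairs. [folklore] -/
theorem exists_mem_edgeSet_trG {e : Sym2 (Site 3)} (hE : e ∈ EH) (h : e ∈ (zdGraph 3).edgeSet ∪ wallPairs) :
    ∃ L : ℕ, e ∈ (trG L).edgeSet := by
  induction e using Sym2.ind with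
  | h u v =>
    obtain ⟨hne, hu, hv⟩ := mk_mem_EH.1 hE
    rcases h with h | h
    · exact ⟨0, (SimpleGraph.mem_edgeSet _).2 (trG_adj.2 ⟨hne, hu, hv, Or.inl ((SimpleGraph.mem_edgeSet _).1 h)⟩)⟩
    · obtain ⟨hu0, hv0, -⟩ := mk_mem_wallPairs.1 h
      exact ⟨⌈‖u - v‖⌉₊, (SimpleGraph.mem_edgeSet _).2 (trG_adj.2 ⟨hne, hu, hv, Or.inr ⟨hu0, hv0, Nat.le_ceil _⟩⟩)⟩

/-- The wall bond `{u, u + x}` of type `x` (`x ∈ ∂H`, `x ≠ 0`) at the wall vertex `u` is a step of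
`trG L` once `‖x‖ ≤ L`. [folklore] -/
theorem mk_add_mem_edgeSet_trG {u x : Site 3} (hu : u 0 = 0) (hx0 : x 0 = 0) (hx : x ≠ 0) {L : ℕ}
    (hL : ‖x‖ ≤ L) : s(u, u + x) ∈ (trG L).edgeSet := by
  rw [SimpleGraph.mem_edgeSet, trG_adj]
  have hux : (u + x) 0 = 0 := by simp [hu, hx0]
  refine ⟨fun h => hx (by simpa using h.symm), le_of_eq hu.symm, le_of_eq hux.symm, Or.inr ⟨hu, hux, ?_⟩⟩
  rwa [sub_add_cancel_left, norm_neg]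

/-! ### Truncated configurations and their `H`-clusters -/

/-- Restricting to `E(trG L)` lands inside `EH`, so `res` is the identity there. [folklore] -/
theorem res_inter_edgeSet_trG (ω : BondConfig (Site 3)) (L : ℕ) :
    res (ω ∩ (trG L).edgeSet) = ω ∩ (trG L).edgeSet := by
  ext e
  simp only [mem_res, Set.mem_inter_iff]
  exact ⟨fun h => h.1, fun h => ⟨h, edgeSet_trG_subset_EH L h.2⟩⟩

/-- Restricting `res ω` or `ω` to `E(trG L)` is the same. [folklore] -/
theorem res_inter_edgeSet_trG' (ω : BondConfig (Site 3)) (L : ℕ) :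
    res ω ∩ (trG L).edgeSet = ω ∩ (trG L).edgeSet := by
  ext e
  simp only [mem_res, Set.mem_inter_iff]
  exact ⟨fun h => ⟨h.1.1, h.2⟩, fun h => ⟨⟨h.1, edgeSet_trG_subset_EH L h.2⟩, h.2⟩⟩

/-- The `H`-cluster of a truncated configuration is its ordinary open cluster (`x ∈ H`). [folklore] -/
theorem clusterH_trunc_eq {x : Site 3} (hx : 0 ≤ x 0) (ω : BondConfig (Site 3)) (L : ℕ) :
    clusterH (ω ∩ (trG L).edgeSet) x = openCluster (ω ∩ (trG L).edgeSet) x := by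
  rw [clusterH_eq hx, res_inter_edgeSet_trG]

/-- Truncated `H`-clusters increase with `L`. [folklore] -/
theorem clusterH_trunc_mono (ω : BondConfig (Site 3)) (x : Site 3) :
    Monotone fun L => clusterH (ω ∩ (trG L).edgeSet) x :=
  fun _ _ h => clusterH_mono (Set.inter_subset_inter_right _ (edgeSet_trG_mono h)) x

/-- Truncated `H`-clusters are contained in `C_H(x)`. [folklore] -/
theorem clusterH_trunc_subset (ω : BondConfig (Site 3)) (L : ℕ) (x : Site 3) :
    clusterH (ω ∩ (trG L).edgeSet) x ⊆ clusterH ω x :=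
  clusterH_mono Set.inter_subset_left x

/-- **An open path uses finitely many pairs**: reachability in `ω ⊆ ⋃_L E_L` (increasing `E`) is
reachability in some `ω ∩ E_L`. [folklore] -/
theorem exists_reachable_inter {V : Type*} {E : ℕ → Set (Sym2 V)} (hE : Monotone E) {ω : BondConfig V}
    (hω : ω ⊆ ⋃ L, E L) {x v : V} (h : (openGraph ω).Reachable x v) :
    ∃ L, (openGraph (ω ∩ E L)).Reachable x v := by
  obtain ⟨p⟩ := h
  induction p with
  | nil => exact ⟨0, SimpleGraph.Reachable.refl _⟩
  | @cons a b c hadj _ ih =>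
    obtain ⟨L₂, hL₂⟩ := ih
    obtain ⟨hmem, hne⟩ := (openGraph_adj ω a b).1 hadj
    obtain ⟨L₁, hL₁⟩ := Set.mem_iUnion.1 (hω hmem)
    refine ⟨max L₁ L₂, ?_⟩
    have hadj' : (openGraph (ω ∩ E (max L₁ L₂))).Adj a b :=
      (openGraph_adj _ a b).2 ⟨⟨hmem, hE (le_max_left _ _) hL₁⟩, hne⟩
    exact hadj'.reachable.trans (hL₂.mono (openGraph_mono (Set.inter_subset_inter_right _ (hE (le_max_right _ _)))))

/-- Every vertex of `C_H(x)` lies in some truncated `H`-cluster, provided `res ω ⊆ ⋃_L E(trG L)`.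
[folklore] -/
theorem exists_mem_clusterH_trunc {ω : BondConfig (Site 3)} (hω : res ω ⊆ ⋃ L, (trG L).edgeSet)
    {x v : Site 3} (hv : v ∈ clusterH ω x) : ∃ L, v ∈ clusterH (ω ∩ (trG L).edgeSet) x := by
  have hx := nonneg_of_mem_clusterH' hv
  rw [clusterH_eq hx] at hv
  obtain ⟨L, hL⟩ := exists_reachable_inter (fun _ _ h => edgeSet_trG_mono h) hω hv
  refine ⟨L, ?_⟩
  rw [clusterH_trunc_eq hx, ← res_inter_edgeSet_trG']
  exact hL

/-- **A finite `H`-cluster is reached by the truncations**: `C_H^{ω ∩ E(trG L)}(x) = C_H^ω(x)` for all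
large `L`. [folklore] -/
theorem eventually_clusterH_trunc_eq {ω : BondConfig (Site 3)} (hω : res ω ⊆ ⋃ L, (trG L).edgeSet)
    {x : Site 3} (hfin : (clusterH ω x).Finite) :
    ∀ᶠ L in atTop, clusterH (ω ∩ (trG L).edgeSet) x = clusterH ω x := by
  have hev : ∀ v ∈ clusterH ω x, ∀ᶠ L in atTop, v ∈ clusterH (ω ∩ (trG L).edgeSet) x := by
    intro v hv
    obtain ⟨L, hL⟩ := exists_mem_clusterH_trunc hω hv
    exact eventually_atTop.2 ⟨L, fun L' hL' => clusterH_trunc_mono ω x hL' hL⟩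
  filter_upwards [(eventually_all_finite hfin).2 hev] with L hL
  exact Set.Subset.antisymm (clusterH_trunc_subset ω L x) hL

/-- **Almost surely only lattice edges and wall pairs are open**, so `res ω ⊆ ⋃_L E(trG L)`. [folklore] -/
theorem ae_res_subset (p : unitInterval) (lam α : ℝ) :
    ∀ᵐ ω ∂(augWall p lam α), res ω ⊆ ⋃ L, (trG L).edgeSet := by
  have h := prodBernoulli_ae_forall_notMem (augProb p lam α) (Z := ((zdGraph 3).edgeSet ∪ wallPairs)ᶜ)
    (Set.to_countable _) (fun e he => by
      rw [Set.mem_compl_iff, Set.mem_union, not_or] at he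
      exact augProb_of_not p lam α he.1 he.2)
  filter_upwards [h] with ω hω
  intro e he
  have he' : e ∈ (zdGraph 3).edgeSet ∪ wallPairs := by
    by_contra hne
    exact hω e hne he.1
  obtain ⟨L, hL⟩ := exists_mem_edgeSet_trG he.2 he'
  exact Set.mem_iUnion.2 ⟨L, hL⟩


end WallTwoGhost

open WallTwoGhost in
/-- **K1, part 2 (truncation).** Almost surely under the augmented model, every finite `H`-cluster is
already the `H`-cluster of the truncated configuration `ω ∩ E(trG L)` for all large `L` (only lattice
edges and wall pairs are open; an open path uses finitely many pairs). [folklore] -/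
theorem wallTwoGhost_ae_trunc : ∀ (p : unitInterval) (lam α : ℝ), ∀ᵐ ω ∂(augWall p lam α), ∀ x : Site 3, (clusterH ω x).Finite → ∀ᶠ L in atTop, clusterH (ω ∩ (trG L).edgeSet) x = clusterH ω x := by
  intro p lam α
  filter_upwards [ae_res_subset p lam α] with ω hω x hfin
  exact eventually_clusterH_trunc_eq hω hfin

end Summit.CriticalPhenomena.PercolationContinuityZ3.Theorems
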